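import Mathlib.RingTheory.MvPolynomial.WeightedHomogeneous
import Literature.Barriers.ValiantsHypothesis.MonotoneGapParseTrees
import Literature.Computability.AlgebraicComplexity.ArithCircuitProofs

/-!
# Crux `ZeroOneTransfer` (stmt-ValiantsHypothesis-5066), line `arborescence-span` —
stub `stub_projClosure`, part 1/2: BOTTOM weighted components are free over `ℝ≥0`

For a weight `w : σ → ℕ` and `p ∈ ℝ≥0[σ]`, `botDegree w p` is the least `w`-weight of a monomial
of `p` and `botComponent w p` the sum of the terms of `p` of that weight.  Mirror image of
`Theorems/ZeroOneTransfer/Negative/TopComponentFree.lean` (sup-based `topComponent`), same proofs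
dualised; over the semiring `ℝ≥0` (no cancellation, no zero divisors):
`botComponent_mul` (`bot_w (p q) = bot_w p · bot_w q`), `botComponent_list_sum` (a weighted sum
keeps its effective summands of minimal bottom degree), and `complexity_botComponent_le` —
**bottom forms are free for monotone circuits**, `L_{ℝ≥0}(bot_w p) ≤ L_{ℝ≥0}(p)` in the tree's
fan-in-two `complexity`, by pruning every sum gate of a size-optimal circuit (`bpruneGate`,
`bprune`); registered on the crux as the sub-stub `stub_projClosure_botFree`.  Part 2
(`DivisionGapZeroOneTransferProjClosure.lean`) applies it with `w` the indicator of the variables a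
Valiant projection sends to `0`.  Imports only `Literature` (no `Theses` file).
Helper namespace `ProjClosure`. [folklore]
-/

noncomputable section

-- `Summit.ValiantsHypothesis.ValiantsHypothesis.…` is the tree's mandated single-conjunct layout
-- (Sub = Summit), so the duplicated namespace component is intended.
set_option linter.dupNamespace false

namespace Summit.ValiantsHypothesis.ValiantsHypothesis.Theorems.DivisionGapZeroOneTransfer

open Literature.Computability.AlgebraicComplexity Literature.Barriers.ValiantsHypothesis
open MvPolynomial Finset
open ArithCircuit (Gate Operand gateValues)
open scoped NNReal

namespace ProjClosure

variable {σ : Type*}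

/-! ### The bottom weighted component over `ℝ≥0` -/

/-- The bottom `w`-degree of `p`: least `w`-weight of a monomial (`0` if `p = 0`). [folklore] -/
def botDegree (w : σ → ℕ) (p : MvPolynomial σ ℝ≥0) : ℕ :=
  sInf (Finsupp.weight w '' (p.support : Set (σ →₀ ℕ)))

/-- The bottom `w`-component of `p`: its terms of minimal `w`-weight. [folklore] -/
def botComponent (w : σ → ℕ) (p : MvPolynomial σ ℝ≥0) : MvPolynomial σ ℝ≥0 :=
  weightedHomogeneousComponent w (botDegree w p) p

variable (w : σ → ℕ)

/-- Every monomial of `p` weighs at least `botDegree w p`. [folklore] -/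
theorem botDegree_le {p : MvPolynomial σ ℝ≥0} {d : σ →₀ ℕ} (hd : d ∈ p.support) :
    botDegree w p ≤ Finsupp.weight w d :=
  Nat.sInf_le ⟨d, hd, rfl⟩

/-- The bottom degree of a nonzero polynomial is attained by a monomial. [folklore] -/
theorem exists_weight_eq_botDegree {p : MvPolynomial σ ℝ≥0} (hp : p ≠ 0) :
    ∃ d ∈ p.support, Finsupp.weight w d = botDegree w p := by
  obtain ⟨d, hd, h⟩ := Nat.sInf_mem
    ((Finset.coe_nonempty.mpr (support_nonempty.mpr hp)).image (Finsupp.weight w))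
  exact ⟨d, hd, h⟩

/-- Coefficients of the bottom component. [folklore] -/
theorem coeff_botComponent (p : MvPolynomial σ ℝ≥0) (d : σ →₀ ℕ) :
    coeff d (botComponent w p) =
      if Finsupp.weight w d = botDegree w p then coeff d p else 0 := by
  classical
  unfold botComponent
  convert coeff_weightedHomogeneousComponent (w := w) (botDegree w p) p d

/-- `bot 0 = 0`. [folklore] -/
@[simp] theorem botComponent_zero : botComponent w (0 : MvPolynomial σ ℝ≥0) = 0 := by
  simp [botComponent]

/-- A nonzero weighted-homogeneous polynomial has its degree as bottom degree. [folklore] -/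
theorem botDegree_eq_of_isWeightedHomogeneous {p : MvPolynomial σ ℝ≥0} {n : ℕ}
    (hp : IsWeightedHomogeneous w p n) (h0 : p ≠ 0) : botDegree w p = n := by
  obtain ⟨d, hd, hdw⟩ := exists_weight_eq_botDegree w h0
  rw [← hdw]
  exact hp (mem_support_iff.mp hd)

/-- A weighted-homogeneous polynomial is its own bottom component. [folklore] -/
theorem botComponent_eq_self_of_isWeightedHomogeneous {p : MvPolynomial σ ℝ≥0} {n : ℕ}
    (hp : IsWeightedHomogeneous w p n) : botComponent w p = p := by
  by_cases h0 : p = 0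
  · simp [h0]
  unfold botComponent
  rw [botDegree_eq_of_isWeightedHomogeneous w hp h0]
  exact hp.weightedHomogeneousComponent_same

/-- `bot (X i) = X i`. [folklore] -/
@[simp] theorem botComponent_X (i : σ) : botComponent w (X i : MvPolynomial σ ℝ≥0) = X i :=
  botComponent_eq_self_of_isWeightedHomogeneous w (isWeightedHomogeneous_X ℝ≥0 w i)

/-- `bot (C c) = C c`. [folklore] -/
@[simp] theorem botComponent_C (c : ℝ≥0) : botComponent w (C c : MvPolynomial σ ℝ≥0) = C c :=
  botComponent_eq_self_of_isWeightedHomogeneous w (isWeightedHomogeneous_C w c)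

/-- `bot 1 = 1`. [folklore] -/
@[simp] theorem botComponent_one : botComponent w (1 : MvPolynomial σ ℝ≥0) = 1 := by
  rw [← C_1]; exact botComponent_C w 1

/-- A nonzero polynomial has a nonzero bottom component. [folklore] -/
theorem botComponent_ne_zero {p : MvPolynomial σ ℝ≥0} (hp : p ≠ 0) : botComponent w p ≠ 0 := by
  obtain ⟨d, hd, hdw⟩ := exists_weight_eq_botDegree w hp
  intro h
  have := congrArg (coeff d) h
  rw [coeff_botComponent, coeff_zero, if_pos hdw] at this
  exact (mem_support_iff.mp hd) this

/-- Over `ℝ≥0`: the bottom degree of a product of nonzero polynomials is additive. [folklore] -/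
theorem botDegree_mul {p q : MvPolynomial σ ℝ≥0} (hp : p ≠ 0) (hq : q ≠ 0) :
    botDegree w (p * q) = botDegree w p + botDegree w q := by
  classical
  apply le_antisymm
  · obtain ⟨a, ha, hsa⟩ := exists_weight_eq_botDegree w hp
    obtain ⟨b, hb, hsb⟩ := exists_weight_eq_botDegree w hq
    have hab : a + b ∈ (p * q).support := by
      rw [JerrumSnir.support_mul_eq]
      exact Finset.add_mem_add ha hb
    rw [← hsa, ← hsb, ← map_add]
    exact botDegree_le w hab
  · obtain ⟨d, hd, hsd⟩ := exists_weight_eq_botDegree w (mul_ne_zero hp hq)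
    obtain ⟨a, ha, b, hb, rfl⟩ := Finset.mem_add.1 (support_mul p q hd)
    rw [← hsd, map_add]
    exact add_le_add (botDegree_le w ha) (botDegree_le w hb)

/-- **Bottom components are multiplicative over `ℝ≥0`.** [folklore] -/
theorem botComponent_mul (p q : MvPolynomial σ ℝ≥0) :
    botComponent w (p * q) = botComponent w p * botComponent w q := by
  classical
  by_cases hp : p = 0
  · simp [hp]
  by_cases hq : q = 0
  · simp [hq]
  have hD := botDegree_mul w hp hq
  refine MvPolynomial.ext _ _ fun d => ?_
  rw [coeff_botComponent, coeff_mul, coeff_mul, hD]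
  split_ifs with hwd
  · refine Finset.sum_congr rfl fun x hx => ?_
    rw [coeff_botComponent, coeff_botComponent]
    have hxd : x.1 + x.2 = d := Finset.HasAntidiagonal.mem_antidiagonal.mp hx
    by_cases hpa : coeff x.1 p = 0
    · simp [hpa]
    by_cases hqb : coeff x.2 q = 0
    · simp [hqb]
    have ha : botDegree w p ≤ Finsupp.weight w x.1 := botDegree_le w (mem_support_iff.mpr hpa)
    have hb : botDegree w q ≤ Finsupp.weight w x.2 := botDegree_le w (mem_support_iff.mpr hqb)
    have hsum : Finsupp.weight w x.1 + Finsupp.weight w x.2 =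
        botDegree w p + botDegree w q := by
      rw [← map_add, hxd, hwd]
    rw [if_pos (by omega), if_pos (by omega)]
  · symm
    refine Finset.sum_eq_zero fun x hx => ?_
    rw [coeff_botComponent, coeff_botComponent]
    have hxd : x.1 + x.2 = d := Finset.HasAntidiagonal.mem_antidiagonal.mp hx
    split_ifs with h1 h2
    · exact absurd (by rw [← hxd, map_add, h1, h2]) hwd
    all_goals simp

/-- Bottom components of list products. [folklore] -/
theorem botComponent_list_prod (l : List (MvPolynomial σ ℝ≥0)) :
    botComponent w l.prod = (l.map (botComponent w)).prod := by
  induction l with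
  | nil => simp
  | cons p l ih => rw [List.prod_cons, botComponent_mul, ih, List.map_cons, List.prod_cons]

/-- Over `ℝ≥0` a list sum of scalar multiples has the union of the supports of its effective
summands, so its bottom degree is at most that of each nonzero effective summand. [folklore] -/
theorem botDegree_sum_le_of_mem (L : List (ℝ≥0 × MvPolynomial σ ℝ≥0))
    {a : ℝ≥0 × MvPolynomial σ ℝ≥0} (ha : a ∈ L) (ha1 : a.1 ≠ 0) (ha2 : a.2 ≠ 0) :
    botDegree w (L.map fun b => b.1 • b.2).sum ≤ botDegree w a.2 := by
  classical
  obtain ⟨d, hd, hdw⟩ := exists_weight_eq_botDegree w ha2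
  rw [← hdw]
  refine botDegree_le w ?_
  rw [JerrumSnir.mem_support_list_sum]
  refine ⟨a.1 • a.2, List.mem_map.mpr ⟨a, ha, rfl⟩, ?_⟩
  rwa [JerrumSnir.support_smul_eq ha1]

/-- Coefficients of a list sum (twin of `ZeroOneTransfer.Negative.coeff_list_sum'`). [folklore] -/
theorem coeff_list_sum' (d : σ →₀ ℕ) (L : List (MvPolynomial σ ℝ≥0)) :
    coeff d L.sum = (L.map (coeff d)).sum := by
  induction L with
  | nil => simp
  | cons p L ih => simp [List.sum_cons, coeff_add, ih]

/-- Sum over a filtered list as a sum with indicators (twin of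
`ZeroOneTransfer.Negative.list_sum_map_filter`). [folklore] -/
theorem list_sum_map_filter {α β : Type*} [AddCommMonoid β] (L : List α) (P : α → Bool)
    (f : α → β) : ((L.filter P).map f).sum = (L.map fun a => if P a then f a else 0).sum := by
  induction L with
  | nil => simp
  | cons a L ih => rw [List.filter_cons]; by_cases h : P a = true <;> simp [h, ih]

/-- **Bottom component of a weighted sum over `ℝ≥0`**: keep exactly the effective summands whose
bottom degree is that of the whole sum. [folklore] -/
theorem botComponent_list_sum [DecidableEq σ] (L : List (ℝ≥0 × MvPolynomial σ ℝ≥0)) :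
    botComponent w (L.map fun b => b.1 • b.2).sum =
      ((L.filter fun b => decide (b.1 ≠ 0 ∧ b.2 ≠ 0 ∧ botDegree w b.2 =
          botDegree w (L.map fun b => b.1 • b.2).sum)).map
        fun b => b.1 • botComponent w b.2).sum := by
  classical
  set S := (L.map fun b => b.1 • b.2).sum with hS
  have key : ∀ b ∈ L, ∀ d : σ →₀ ℕ,
      (if (b.1 ≠ 0 ∧ b.2 ≠ 0 ∧ botDegree w b.2 = botDegree w S) then
          b.1 * coeff d (botComponent w b.2) else 0) =
        if Finsupp.weight w d = botDegree w S then b.1 * coeff d b.2 else 0 := by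
    intro b hb d
    rw [coeff_botComponent]
    by_cases h1 : b.1 = 0
    · simp [h1]
    by_cases h2 : b.2 = 0
    · simp [h2]
    by_cases h3 : botDegree w b.2 = botDegree w S
    · simp [h1, h2, h3]
    · rw [if_neg (by simp [h3])]
      split_ifs with h4
      · -- `weight d = bot S < bot b.2`, so `d ∉ supp b.2`
        have hle : botDegree w S ≤ botDegree w b.2 :=
          hS ▸ botDegree_sum_le_of_mem w L hb h1 h2
        have hne : Finsupp.weight w d ≠ botDegree w b.2 := by
          rw [h4]; exact fun h => h3 h.symm
        have hlt : Finsupp.weight w d < botDegree w b.2 := lt_of_le_of_ne (h4 ▸ hle) hne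
        have : coeff d b.2 = 0 := by
          by_contra hne'
          exact absurd (botDegree_le w (mem_support_iff.mpr hne')) (not_le.mpr hlt)
        rw [this, mul_zero]
      · rfl
  refine MvPolynomial.ext _ _ fun d => ?_
  rw [coeff_botComponent, list_sum_map_filter, coeff_list_sum', coeff_list_sum', List.map_map,
    List.map_map]
  have hR : (L.map (coeff d ∘ fun a => if decide (a.1 ≠ 0 ∧ a.2 ≠ 0 ∧
      botDegree w a.2 = botDegree w S) then a.1 • botComponent w a.2
      else 0)) = L.map fun b =>
        if Finsupp.weight w d = botDegree w S then b.1 * coeff d b.2 else 0 := by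
    refine List.map_congr_left fun b hb => ?_
    rw [← key b hb d]
    simp only [Function.comp_apply, decide_eq_true_eq]
    split_ifs <;> simp [coeff_smul]
  rw [hR]
  by_cases hwd : Finsupp.weight w d = botDegree w S
  · simp only [hwd, if_true]
    exact congrArg List.sum (List.map_congr_left fun b _ => by
      simp only [Function.comp_apply, coeff_smul, smul_eq_mul])
  · simp only [hwd, if_false]
    symm
    exact List.sum_eq_zero (fun x hx => by
      obtain ⟨b, -, rfl⟩ := List.mem_map.mp hx; rfl)

/-! ### Pruning a fan-in-two circuit over `ℝ≥0` to the bottom component -/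

open Classical in
/-- Prune one gate against the ORIGINAL values `vals` of the earlier gates: a sum gate keeps its
effective operands whose (nonzero) value has the bottom degree of the gate's value; a product
gate is unchanged. [folklore] -/
def bpruneGate (vals : List (MvPolynomial σ ℝ≥0)) : Gate ℝ≥0 σ → Gate ℝ≥0 σ
  | .sum args => .sum (args.filter fun a => decide (a.1 ≠ 0 ∧ a.2.eval vals ≠ 0 ∧
      botDegree w (a.2.eval vals) =
        botDegree w ((args.map fun b => b.1 • b.2.eval vals).sum)))
  | .prod args => .prod args

/-- Prune a gate list, threading the original gate values (a left fold). [folklore] -/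
def bpruneAux (gs : List (Gate ℝ≥0 σ)) : List (Gate ℝ≥0 σ) × List (MvPolynomial σ ℝ≥0) :=
  gs.foldl (fun acc g => (acc.1 ++ [bpruneGate w acc.2 g], acc.2 ++ [g.eval acc.2])) ([], [])

/-- One step of the fold. [folklore] -/
theorem bpruneAux_append_singleton (gs : List (Gate ℝ≥0 σ)) (g : Gate ℝ≥0 σ) :
    bpruneAux w (gs ++ [g]) =
      ((bpruneAux w gs).1 ++ [bpruneGate w (bpruneAux w gs).2 g],
        (bpruneAux w gs).2 ++ [g.eval (bpruneAux w gs).2]) := by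
  simp [bpruneAux, List.foldl_append]

/-- The threaded values are the original gate values. [folklore] -/
theorem bpruneAux_snd (gs : List (Gate ℝ≥0 σ)) : (bpruneAux w gs).2 = gateValues gs := by
  induction gs using List.reverseRecOn with
  | nil => rfl
  | append_singleton gs g ih =>
    rw [bpruneAux_append_singleton, ArithCircuit.gateValues_append_singleton, ih]

/-- Pruning keeps the number of gates. [folklore] -/
theorem bpruneAux_length (gs : List (Gate ℝ≥0 σ)) : (bpruneAux w gs).1.length = gs.length := by
  induction gs using List.reverseRecOn with
  | nil => rfl
  | append_singleton gs g ih => simp [bpruneAux_append_singleton, ih]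

/-- Every pruned gate is the pruning of an original gate. [folklore] -/
theorem mem_bpruneAux {gs : List (Gate ℝ≥0 σ)} {g : Gate ℝ≥0 σ} (hg : g ∈ (bpruneAux w gs).1) :
    ∃ vals g₀, g₀ ∈ gs ∧ g = bpruneGate w vals g₀ := by
  induction gs using List.reverseRecOn with
  | nil => simp [bpruneAux] at hg
  | append_singleton gs g' ih =>
    rw [bpruneAux_append_singleton] at hg
    simp only [List.mem_append, List.mem_singleton] at hg
    rcases hg with hg | rfl
    · obtain ⟨vals, g₀, h₀, rfl⟩ := ih hg
      exact ⟨vals, g₀, List.mem_append_left _ h₀, rfl⟩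
    · exact ⟨_, g', by simp, rfl⟩

/-- Pruning does not increase the fan-in. [folklore] -/
theorem fanIn_bpruneGate_le (vals : List (MvPolynomial σ ℝ≥0)) (g : Gate ℝ≥0 σ) :
    (bpruneGate w vals g).fanIn ≤ g.fanIn := by
  cases g with
  | sum args =>
    simp only [bpruneGate, Gate.fanIn, ArithCircuit.Gate.args, List.length_map]
    exact List.length_filter_le _ _
  | prod args => simp [bpruneGate]

/-- Operands read bottom components off the list of bottom components. [folklore] -/
theorem operand_eval_map_botComponent (vals : List (MvPolynomial σ ℝ≥0)) (u : Operand ℝ≥0 σ) :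
    u.eval (vals.map (botComponent w)) = botComponent w (u.eval vals) := by
  cases u with
  | var i => simp [Operand.eval]
  | const c => simp [Operand.eval]
  | gate j =>
    simp only [ArithCircuit.Operand.eval_gate, List.getD_eq_getElem?_getD, List.getElem?_map]
    cases vals[j]? with
    | none => simp
    | some v => simp

/-- **The pruned gate computes the bottom component of the original gate's value**
(`botComponent_list_sum` for sum gates, `botComponent_list_prod` for product gates). [folklore] -/
theorem bpruneGate_eval [DecidableEq σ] (vals : List (MvPolynomial σ ℝ≥0)) (g : Gate ℝ≥0 σ) :
    (bpruneGate w vals g).eval (vals.map (botComponent w)) = botComponent w (g.eval vals) := by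
  classical
  cases g with
  | sum args =>
    simp only [bpruneGate, Gate.eval]
    have hS : ((args.map fun a => (a.1, a.2.eval vals)).map fun b => b.1 • b.2) =
        args.map fun b => b.1 • b.2.eval vals := by
      rw [List.map_map]; rfl
    rw [← hS, botComponent_list_sum]
    simp only [List.filter_map, List.map_map, list_sum_map_filter, Function.comp_def,
      operand_eval_map_botComponent]
  | prod args =>
    simp only [bpruneGate, Gate.eval]
    rw [botComponent_list_prod, List.map_map]
    congr 1
    refine List.map_congr_left fun u _ => ?_
    simp only [Function.comp_apply, operand_eval_map_botComponent]

/-- The pruned circuit: pruned gates, same output operand. [folklore] -/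
def bprune (P : ArithCircuit ℝ≥0 σ) : ArithCircuit ℝ≥0 σ where
  gates := (bpruneAux w P.gates).1
  output := P.output

/-- The values of the pruned gates are the bottom components of the original values. [folklore] -/
theorem gateValues_bpruneAux [DecidableEq σ] (gs : List (Gate ℝ≥0 σ)) :
    gateValues (bpruneAux w gs).1 = (gateValues gs).map (botComponent w) := by
  induction gs using List.reverseRecOn with
  | nil => rfl
  | append_singleton gs g ih =>
    rw [bpruneAux_append_singleton, ArithCircuit.gateValues_append_singleton,
      ArithCircuit.gateValues_append_singleton, ih, bpruneAux_snd, List.map_append,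
      List.map_singleton, bpruneGate_eval]

/-- The pruned circuit computes the bottom component. [folklore] -/
theorem eval_bprune [DecidableEq σ] (P : ArithCircuit ℝ≥0 σ) :
    (bprune w P).eval = botComponent w P.eval := by
  simp only [ArithCircuit.eval, bprune]
  rw [gateValues_bpruneAux, operand_eval_map_botComponent]

/-- Pruning keeps the size. [folklore] -/
theorem size_bprune (P : ArithCircuit ℝ≥0 σ) : (bprune w P).size = P.size :=
  bpruneAux_length w P.gates

/-- Pruning keeps fan-in two. [folklore] -/
theorem isFanInTwo_bprune {P : ArithCircuit ℝ≥0 σ} (h : P.IsFanInTwo) :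
    (bprune w P).IsFanInTwo := by
  intro g hg
  obtain ⟨vals, g₀, h₀, rfl⟩ := mem_bpruneAux w hg
  exact (fanIn_bpruneGate_le w vals g₀).trans (h g₀ h₀)

/-- **Bottom forms are free for monotone circuits over `ℝ≥0`**: `L(bot_w p) ≤ L(p)` in the
tree's fan-in-two `complexity` over the semiring `ℝ≥0`, for every weight `w : σ → ℕ`. [folklore] -/
theorem complexity_botComponent_le (p : MvPolynomial σ ℝ≥0) :
    complexity (botComponent w p) ≤ complexity p := by
  classical
  obtain ⟨P, h2, hP, hsize⟩ := ArithCircuit.exists_computes_size_eq_complexity p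
  rw [← hsize, ← size_bprune w P]
  refine ArithCircuit.complexity_le_size (isFanInTwo_bprune w h2) ?_
  show (bprune w P).eval = botComponent w p
  rw [eval_bprune, show P.eval = p from hP]

end ProjClosure

/-- **Registered sub-stub `stub_projClosure_botFree`** (auxiliary goal of `stub_projClosure`, in
Mathlib vocabulary): bottom weighted forms are free for monotone circuits over `ℝ≥0` —
`ProjClosure.complexity_botComponent_le` with `botComponent`/`botDegree` unfolded. [folklore] -/
theorem stub_projClosure_botFree :
    ∀ (σ : Type) (w : σ → ℕ) (p : MvPolynomial σ NNReal),
      Literature.Computability.AlgebraicComplexity.complexity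
          (MvPolynomial.weightedHomogeneousComponent w
            (sInf (Finsupp.weight w '' (p.support : Set (σ →₀ ℕ)))) p) ≤
        Literature.Computability.AlgebraicComplexity.complexity p :=
  fun _ w p => ProjClosure.complexity_botComponent_le w p

end Summit.ValiantsHypothesis.ValiantsHypothesis.Theorems.DivisionGapZeroOneTransfer
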